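import Mathlib
import Summits.NavierStokesRegularity.OSWSelfSimilar.HouLuoOriginLaws
import HarnessLib

/-!
# Viscous gCLM/OSW profile MODEL: the TEST-FUNCTION identity of the frozen-`ε` sheet map on the half-line
# (test `F₁` against `Φ′(Ω)` for a convex `C²` function `Φ` with `Φ(0) = Φ′(0) = 0`)

HONEST FRAMING (cell ns-blowup GROUP B «PROFILE SEARCH», zone Z3 = the 1-D viscous gCLM/OSW sheet; human rulings
D-0035/D-0074): **1-D MODEL; one-variable calculus kernel-checked; not Euler, not Navier–Stokes; «violates: none — MODEL».**
Nothing in this file is a statement about Navier–Stokes.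

OBJECT. The frozen-`ε` profile map of the viscous generalised Constantin–Lax–Majda / Okamoto–Sakajo–Wunsch model in the
cell's gauge (HOME/profile/z3/SHEET.md §1.2),
  `F₁(ξ) = c_ω Ω + c_l ξ Ω′ + a 𝒰 Ω′ − b (HΩ) Ω − P − ε Ω″`   (`HouLuoOriginLaws.F1`; gCLM/OSW sheet: `b = 1`, `P = 0`),
with `𝒰′ = H`; as in `SheetHalfLineIdentity`, `H` and `U = 𝒰` are ARBITRARY real functions tied only by `𝒰′ = H` — everything
here is calculus on the half-line `(0,∞)`.

WHAT IS KERNEL-CHECKED HERE (the common parent of the half-line identity (★) of `SheetHalfLineIdentity.halfLine_identity`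
— test against `𝟙`, i.e. `Φ(s) = s`… up to the origin term — and of the energy identity (E) `SheetHalfLineIdentity.energy_identity`
— test against `Ω`, i.e. `Φ(s) = s²/2`): for ANY `C²` test function `Φ` (`Φ′ = dΦ`, `Φ″ = ddΦ`),
* `hasDerivAt_testBoundary` — the POINTWISE identity behind every such test: where `F₁(ξ) = 0`,
    `(c_l ξ Φ(Ω) + a 𝒰 Φ(Ω) − ε Ω′ Φ′(Ω))′ = −[c_ω ΩΦ′(Ω) − c_l Φ(Ω) − a H Φ(Ω) − b H Ω Φ′(Ω) − P Φ′(Ω)] − ε Ω′² Φ″(Ω)`;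
* `integral_Ioi_test_le` — **THE CONVEX-TEST INEQUALITY on the half-line**: if `ε ≥ 0`, `Φ″ ≥ 0`, `Φ(0) = Φ′(0) = 0`,
  `Ω(0) = 0`, `F₁ ≡ 0` on `(0,∞)`, the bracket `I := c_ω ΩΦ′(Ω) − c_l Φ(Ω) − a H Φ(Ω) − b H Ω Φ′(Ω) − P Φ′(Ω)` is integrable on
  `(0,∞)` and the boundary terms `ξΦ(Ω)`, `𝒰Φ(Ω)`, `Ω′Φ′(Ω)` tend to `0` at `+∞`, then
    `∫₀^∞ [c_ω ΩΦ′(Ω) − c_l Φ(Ω) − a H Φ(Ω) − b H Ω Φ′(Ω) − P Φ′(Ω)] ≤ 0`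
  (the dissipation `ε∫₀^∞ Ω′²Φ″(Ω) ≥ 0` is DROPPED — it need not even be finite; no integrability of `Ω′²` is assumed);
* `integral_Ioi_test_eq` — the exact version when `Ω′²Φ″(Ω) ∈ L¹(0,∞)`:
    `∫₀^∞ I + ε ∫₀^∞ Ω′²Φ″(Ω) = 0`.
USE (companion files `SheetLpPower`, `SheetNSLineLpEmpty`): with the regularised power `Φ_δ(s) = (s²+δ)^{p/2} − δ^{p/2}`, `p ≥ 1`,
and `δ → 0⁺` the inequality becomes the SIGN-FREE `L^p` family `(p c_ω − c_l)∫₀^∞|Ω|^p ≤ (a + p)∫₀^∞ (HΩ)|Ω|^p`, whose member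
`p = |a|` (`a ≤ −1`) empties the collapse sheet `{c_l < |a| c_ω}` — the steady shadow of the monotone quantity `‖ω‖_{L^{|a|}}` of
[Chen 2020, Thm 1.5] (cited for context in `Literature.Analysis.FluidPDE.Chen2020DissipativeGCLM`, not restated).
NOT PROVED HERE: anything nonlocal (the sign of any `H`-pairing), any limit `δ → 0`, existence of anything, anything about
Euler or NS. No definitions; no `def … : Prop` hypotheses; standard axioms.
bears_on: LADDER-NS N5 / zone Z3 row Z3-E12⁻ clause (i′) (CENSUS-Z3 v2.14 §0) → N1 linear core; SELFSIM-NOGO M7/M8 MODEL side.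
-/

noncomputable section
open Set Filter Topology MeasureTheory

namespace Summit.NavierStokesRegularity.OSWSelfSimilar
namespace SheetHalfLine
open HouLuoOriginLaws (F1)

/-! ### The pointwise identity -/

/-- **The pointwise test identity.** For `C²` functions `Ω` (`Ω′ = dOm`, `Ω″ = ddOm`) and `Φ` (`Φ′ = dΦ`, `Φ″ = ddΦ`), `𝒰′ = H`,
at a point `ξ` where `F₁(c_ω, c_l, a, b, ε; H, 𝒰, Ω, P)(ξ) = 0`, the boundary function
`B = c_l ξ Φ(Ω) + a 𝒰 Φ(Ω) − ε Ω′ Φ′(Ω)` has derivative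
`−[c_ω ΩΦ′(Ω) − c_l Φ(Ω) − a H Φ(Ω) − b H Ω Φ′(Ω) − P Φ′(Ω)] − ε Ω′² Φ″(Ω)` (multiply `F₁ = 0` by `Φ′(Ω)` and use the
product/chain rules). [new here — MODEL] -/
theorem hasDerivAt_testBoundary (cω cl a b ε : ℝ) (H U Om dOm ddOm P Φ dΦ ddΦ : ℝ → ℝ) (ξ : ℝ)
    (hΦ : ∀ s, HasDerivAt Φ (dΦ s) s) (hdΦ : ∀ s, HasDerivAt dΦ (ddΦ s) s)
    (hU : HasDerivAt U (H ξ) ξ) (hOm : HasDerivAt Om (dOm ξ) ξ) (hdOm : HasDerivAt dOm (ddOm ξ) ξ)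
    (hF : F1 cω cl a b ε H U Om dOm ddOm P ξ = 0) :
    HasDerivAt (fun x => cl * (x * Φ (Om x)) + a * (U x * Φ (Om x)) - ε * (dOm x * dΦ (Om x)))
      (-(cω * (Om ξ * dΦ (Om ξ)) - cl * Φ (Om ξ) - a * (H ξ * Φ (Om ξ)) - b * (H ξ * Om ξ * dΦ (Om ξ))
          - P ξ * dΦ (Om ξ)) - ε * (dOm ξ ^ 2 * ddΦ (Om ξ))) ξ := by
  have hΦOm : HasDerivAt (fun x => Φ (Om x)) (dΦ (Om ξ) * dOm ξ) ξ := (hΦ (Om ξ)).comp ξ hOm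
  have hdΦOm : HasDerivAt (fun x => dΦ (Om x)) (ddΦ (Om ξ) * dOm ξ) ξ := (hdΦ (Om ξ)).comp ξ hOm
  have h1 : HasDerivAt (fun x => cl * (x * Φ (Om x))) (cl * (1 * Φ (Om ξ) + ξ * (dΦ (Om ξ) * dOm ξ))) ξ :=
    ((hasDerivAt_id' ξ).fun_mul hΦOm).const_mul cl
  have h2 : HasDerivAt (fun x => a * (U x * Φ (Om x))) (a * (H ξ * Φ (Om ξ) + U ξ * (dΦ (Om ξ) * dOm ξ))) ξ :=
    (hU.fun_mul hΦOm).const_mul a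
  have h3 : HasDerivAt (fun x => ε * (dOm x * dΦ (Om x))) (ε * (ddOm ξ * dΦ (Om ξ) + dOm ξ * (ddΦ (Om ξ) * dOm ξ))) ξ :=
    (hdOm.fun_mul hdΦOm).const_mul ε
  refine ((h1.fun_add h2).fun_sub h3).congr_deriv ?_
  have e : cω * Om ξ + cl * ξ * dOm ξ + a * U ξ * dOm ξ - b * H ξ * Om ξ - P ξ - ε * ddOm ξ = 0 := by
    simpa [F1] using hF
  linear_combination (dΦ (Om ξ)) * e

/-! ### The convex-test inequality and the exact identity on `(0,∞)` -/

/-- **THE CONVEX-TEST INEQUALITY on the half-line.** Let `Ω` be `C²` with `Ω(0) = 0`, `𝒰′ = H`, and `F₁ ≡ 0` on `(0,∞)`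
(`ε ≥ 0`); let `Φ` be `C²` with CONTINUOUS `Φ″ ≥ 0` and `Φ(0) = Φ′(0) = 0`. If the bracket
`I = c_ω ΩΦ′(Ω) − c_l Φ(Ω) − a H Φ(Ω) − b H Ω Φ′(Ω) − P Φ′(Ω)` is integrable on `(0,∞)` and `ξΦ(Ω(ξ)) → 0`, `𝒰(ξ)Φ(Ω(ξ)) → 0`,
`Ω′(ξ)Φ′(Ω(ξ)) → 0` as `ξ → +∞`, then `∫₀^∞ I ≤ 0`. Proof: by `hasDerivAt_testBoundary`, on `[0,R]`
`∫₀^R I = −B(R) − ε∫₀^R Ω′²Φ″(Ω) ≤ −B(R)` (`B(0) = 0`), and `B(R) → 0`. The dissipation is only used through its sign — no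
integrability of `Ω′²` is needed. [new here — MODEL] -/
theorem integral_Ioi_test_le (cω cl a b ε : ℝ) (H U Om dOm ddOm P Φ dΦ ddΦ : ℝ → ℝ) (hε : 0 ≤ ε)
    (hΦ : ∀ s, HasDerivAt Φ (dΦ s) s) (hdΦ : ∀ s, HasDerivAt dΦ (ddΦ s) s) (hddΦc : Continuous ddΦ)
    (hddΦ : ∀ s, 0 ≤ ddΦ s) (hΦ0 : Φ 0 = 0) (hdΦ0 : dΦ 0 = 0)
    (hU : ∀ ξ, HasDerivAt U (H ξ) ξ) (hOm : ∀ ξ, HasDerivAt Om (dOm ξ) ξ) (hdOm : ∀ ξ, HasDerivAt dOm (ddOm ξ) ξ)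
    (hOm0 : Om 0 = 0)
    (hF : ∀ ξ ∈ Ioi (0:ℝ), F1 cω cl a b ε H U Om dOm ddOm P ξ = 0)
    (iI : IntegrableOn (fun ξ => cω * (Om ξ * dΦ (Om ξ)) - cl * Φ (Om ξ) - a * (H ξ * Φ (Om ξ))
      - b * (H ξ * Om ξ * dΦ (Om ξ)) - P ξ * dΦ (Om ξ)) (Ioi 0))
    (h1 : Tendsto (fun ξ => ξ * Φ (Om ξ)) atTop (𝓝 0)) (h2 : Tendsto (fun ξ => U ξ * Φ (Om ξ)) atTop (𝓝 0))
    (h3 : Tendsto (fun ξ => dOm ξ * dΦ (Om ξ)) atTop (𝓝 0)) :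
    ∫ ξ in Ioi (0:ℝ), (cω * (Om ξ * dΦ (Om ξ)) - cl * Φ (Om ξ) - a * (H ξ * Φ (Om ξ))
      - b * (H ξ * Om ξ * dΦ (Om ξ)) - P ξ * dΦ (Om ξ)) ≤ 0 := by
  -- names
  set I : ℝ → ℝ := fun ξ => cω * (Om ξ * dΦ (Om ξ)) - cl * Φ (Om ξ) - a * (H ξ * Φ (Om ξ))
      - b * (H ξ * Om ξ * dΦ (Om ξ)) - P ξ * dΦ (Om ξ) with hI
  set B : ℝ → ℝ := fun x => cl * (x * Φ (Om x)) + a * (U x * Φ (Om x)) - ε * (dOm x * dΦ (Om x)) with hB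
  set D : ℝ → ℝ := fun ξ => dOm ξ ^ 2 * ddΦ (Om ξ) with hD
  -- continuity
  have hOmc : Continuous Om := continuous_iff_continuousAt.mpr fun x => (hOm x).continuousAt
  have hdOmc : Continuous dOm := continuous_iff_continuousAt.mpr fun x => (hdOm x).continuousAt
  have hUc : Continuous U := continuous_iff_continuousAt.mpr fun x => (hU x).continuousAt
  have hΦc : Continuous Φ := continuous_iff_continuousAt.mpr fun x => (hΦ x).continuousAt
  have hdΦc : Continuous dΦ := continuous_iff_continuousAt.mpr fun x => (hdΦ x).continuousAt
  have hBc : Continuous B :=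
    ((continuous_const.mul (continuous_id.mul (hΦc.comp hOmc))).add
      (continuous_const.mul (hUc.mul (hΦc.comp hOmc)))).sub
      (continuous_const.mul (hdOmc.mul (hdΦc.comp hOmc)))
  have hDc : Continuous D := (hdOmc.pow 2).mul (hddΦc.comp hOmc)
  have hD0 : ∀ ξ, 0 ≤ D ξ := fun ξ => mul_nonneg (sq_nonneg _) (hddΦ _)
  -- the derivative of `B` on `(0,∞)`
  have hB' : ∀ ξ ∈ Ioi (0:ℝ), HasDerivAt B (-I ξ - ε * D ξ) ξ := fun ξ hξ =>
    hasDerivAt_testBoundary cω cl a b ε H U Om dOm ddOm P Φ dΦ ddΦ ξ hΦ hdΦ (hU ξ) (hOm ξ) (hdOm ξ) (hF ξ hξ)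
  have hB0 : B 0 = 0 := by simp [hB, hOm0, hΦ0, hdΦ0]
  -- on `[0,R]`: `∫₀^R I = -B R - ε ∫₀^R D ≤ -B R`
  have hR : ∀ R ∈ Ioi (0:ℝ), ∫ ξ in (0:ℝ)..R, I ξ ≤ -B R := by
    intro R hR
    have hRle : (0:ℝ) ≤ R := le_of_lt hR
    have iIR : IntervalIntegrable I volume 0 R :=
      (intervalIntegrable_iff_integrableOn_Ioc_of_le hRle).2 (iI.mono_set Ioc_subset_Ioi_self)
    have iDR : IntervalIntegrable (fun ξ => ε * D ξ) volume 0 R := (hDc.const_mul ε |>.intervalIntegrable 0 R)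
    have iInR : IntervalIntegrable (fun ξ => -I ξ) volume 0 R := iIR.neg
    have hint : IntervalIntegrable (fun ξ => -I ξ - ε * D ξ) volume 0 R := iInR.sub iDR
    have hftc := intervalIntegral.integral_eq_sub_of_hasDerivAt_of_le hRle hBc.continuousOn
      (fun x hx => hB' x hx.1) hint
    rw [intervalIntegral.integral_sub iInR iDR, intervalIntegral.integral_neg, hB0, sub_zero] at hftc
    have hDnn : 0 ≤ ∫ ξ in (0:ℝ)..R, ε * D ξ :=
      intervalIntegral.integral_nonneg hRle fun ξ _ => mul_nonneg hε (hD0 ξ)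
    linarith
  -- let `R → ∞`
  have hlim : Tendsto (fun R => ∫ ξ in (0:ℝ)..R, I ξ) atTop (𝓝 (∫ ξ in Ioi (0:ℝ), I ξ)) :=
    intervalIntegral_tendsto_integral_Ioi 0 iI tendsto_id
  have hBlim0 : Tendsto B atTop (𝓝 0) := by
    have h := ((h1.const_mul cl).add (h2.const_mul a)).sub (h3.const_mul ε)
    simp only [mul_zero, add_zero, sub_zero] at h
    exact h
  have hBlim : Tendsto (fun R => -B R) atTop (𝓝 0) := by
    have h := hBlim0.neg
    rw [neg_zero] at h
    exact h
  refine le_of_tendsto_of_tendsto hlim hBlim ?_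
  filter_upwards [Ioi_mem_atTop (0:ℝ)] with R hRpos using hR R hRpos

/-- **The exact test identity on the half-line** (same setting; no sign hypotheses, but the dissipation density
`Ω′²Φ″(Ω)` integrable on `(0,∞)`): `∫₀^∞ [c_ω ΩΦ′(Ω) − c_l Φ(Ω) − a H Φ(Ω) − b H Ω Φ′(Ω) − P Φ′(Ω)] + ε∫₀^∞ Ω′²Φ″(Ω) = 0`.
With `Φ(s) = s²` on the odd class this is twice the energy identity (E) restricted to `(0,∞)`. [new here — MODEL] -/
theorem integral_Ioi_test_eq (cω cl a b ε : ℝ) (H U Om dOm ddOm P Φ dΦ ddΦ : ℝ → ℝ)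
    (hΦ : ∀ s, HasDerivAt Φ (dΦ s) s) (hdΦ : ∀ s, HasDerivAt dΦ (ddΦ s) s)
    (hΦ0 : Φ 0 = 0) (hdΦ0 : dΦ 0 = 0)
    (hU : ∀ ξ, HasDerivAt U (H ξ) ξ) (hOm : ∀ ξ, HasDerivAt Om (dOm ξ) ξ) (hdOm : ∀ ξ, HasDerivAt dOm (ddOm ξ) ξ)
    (hOm0 : Om 0 = 0)
    (hF : ∀ ξ ∈ Ioi (0:ℝ), F1 cω cl a b ε H U Om dOm ddOm P ξ = 0)
    (iI : IntegrableOn (fun ξ => cω * (Om ξ * dΦ (Om ξ)) - cl * Φ (Om ξ) - a * (H ξ * Φ (Om ξ))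
      - b * (H ξ * Om ξ * dΦ (Om ξ)) - P ξ * dΦ (Om ξ)) (Ioi 0))
    (iD : IntegrableOn (fun ξ => dOm ξ ^ 2 * ddΦ (Om ξ)) (Ioi 0))
    (h1 : Tendsto (fun ξ => ξ * Φ (Om ξ)) atTop (𝓝 0)) (h2 : Tendsto (fun ξ => U ξ * Φ (Om ξ)) atTop (𝓝 0))
    (h3 : Tendsto (fun ξ => dOm ξ * dΦ (Om ξ)) atTop (𝓝 0)) :
    (∫ ξ in Ioi (0:ℝ), (cω * (Om ξ * dΦ (Om ξ)) - cl * Φ (Om ξ) - a * (H ξ * Φ (Om ξ))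
      - b * (H ξ * Om ξ * dΦ (Om ξ)) - P ξ * dΦ (Om ξ))) + ε * (∫ ξ in Ioi (0:ℝ), dOm ξ ^ 2 * ddΦ (Om ξ)) = 0 := by
  set I : ℝ → ℝ := fun ξ => cω * (Om ξ * dΦ (Om ξ)) - cl * Φ (Om ξ) - a * (H ξ * Φ (Om ξ))
      - b * (H ξ * Om ξ * dΦ (Om ξ)) - P ξ * dΦ (Om ξ) with hI
  set B : ℝ → ℝ := fun x => cl * (x * Φ (Om x)) + a * (U x * Φ (Om x)) - ε * (dOm x * dΦ (Om x)) with hB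
  set D : ℝ → ℝ := fun ξ => dOm ξ ^ 2 * ddΦ (Om ξ) with hD
  have hOmc : Continuous Om := continuous_iff_continuousAt.mpr fun x => (hOm x).continuousAt
  have hdOmc : Continuous dOm := continuous_iff_continuousAt.mpr fun x => (hdOm x).continuousAt
  have hUc : Continuous U := continuous_iff_continuousAt.mpr fun x => (hU x).continuousAt
  have hΦc : Continuous Φ := continuous_iff_continuousAt.mpr fun x => (hΦ x).continuousAt
  have hdΦc : Continuous dΦ := continuous_iff_continuousAt.mpr fun x => (hdΦ x).continuousAt
  have hBc : Continuous B :=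
    ((continuous_const.mul (continuous_id.mul (hΦc.comp hOmc))).add
      (continuous_const.mul (hUc.mul (hΦc.comp hOmc)))).sub
      (continuous_const.mul (hdOmc.mul (hdΦc.comp hOmc)))
  have hB' : ∀ ξ ∈ Ioi (0:ℝ), HasDerivAt B (-I ξ - ε * D ξ) ξ := fun ξ hξ =>
    hasDerivAt_testBoundary cω cl a b ε H U Om dOm ddOm P Φ dΦ ddΦ ξ hΦ hdΦ (hU ξ) (hOm ξ) (hdOm ξ) (hF ξ hξ)
  have hB0 : B 0 = 0 := by simp [hB, hOm0, hΦ0, hdΦ0]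
  have hBlim : Tendsto B atTop (𝓝 0) := by
    have h := ((h1.const_mul cl).add (h2.const_mul a)).sub (h3.const_mul ε)
    simp only [mul_zero, add_zero, sub_zero] at h
    exact h
  have iIn : IntegrableOn (fun ξ => -I ξ) (Ioi 0) := iI.neg
  have iεD : IntegrableOn (fun ξ => ε * D ξ) (Ioi 0) := iD.const_mul ε
  have iB' : IntegrableOn (fun ξ => -I ξ - ε * D ξ) (Ioi 0) := iIn.sub iεD
  have hBcw : ContinuousWithinAt B (Ici 0) 0 := hBc.continuousWithinAt
  have hkey := integral_Ioi_of_hasDerivAt_of_tendsto hBcw hB' iB' hBlim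
  rw [integral_sub iIn iεD, integral_neg, integral_const_mul, hB0, sub_zero] at hkey
  linarith

end SheetHalfLine
end Summit.NavierStokesRegularity.OSWSelfSimilar
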